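import Literature.MathematicalPhysics.QuantumFieldTheory.Balaban1983to89.Node00.OpsYRecordV4P

/-!
# `Balaban1983to89.Node00.OpsYSectDQ` — [Balaban1985BackgroundPropagators] Sect. A–E's nine `Q`-dependent letters REBUILT OVER A GENERIC
# AVERAGING PAIR `(𝔮, 𝔮⋆)`: `Δ_a, G = Δ_a⁻¹` (3.26)–(3.27), `G̃ = (Δ_π + DRD* + 𝔮⋆a𝔮)⁻¹` (3.122), `(𝔮G̃𝔮⋆)⁻¹` (3.123), `H = G̃𝔮⋆(𝔮G̃𝔮⋆)⁻¹` (3.126),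
# `G₁` (3.128), `(𝔮G₁𝔮⋆)⁻¹` (3.132), `H₁` (3.129), `𝔊 = 𝔓G₁` (3.153), `G(Ω,U) − G(Ω′,U)` (3.154); the record update `CovLettersY.withQ` and
# def-Y's v10 letter family `covLettersY_v10 𝔮 𝔮⋆` (R2-A step (3), director-ym №375) — Node 00 instance layer (def-Y)

statement-level skeleton of published theorems with citation tags; proofs where landed; nothing here is a claim about the
Yang–Mills mass gap

`[Balaban1985BackgroundPropagators]` (CMP **99** (1985) 389–434) (3.26) p. 395: *«Δ_a = Δ + DRD* + Q*aQ»*, (3.27) «G(U) = Δ_a(U)⁻¹»; (3.122) p. 420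
«G̃⁻¹ = Δ_π + DRD* + Q*aQ»; (3.123) «ω = (QG̃Q*)⁻¹B»; (3.126) «HB = G̃Q*(QG̃Q*)⁻¹B»; (3.128)–(3.129) p. 421 (`G₁`, `H₁ = G₁Q*(QG₁Q*)⁻¹`); (3.132) p. 422;
(3.147) p. 425 «𝔓 = I − G₁Q*(QG₁Q*)⁻¹Q − G₁DRD*»; (3.153) p. 426; Thm 3.14 (3.154) pp. 426–427 («G(Ω,U) − G(Ω′,U)»); (3.115) p. 418 (the averaging `Q`
of the variational problem is the linearisation of [5]'s average — NOT the straight-contour `Q` of (3.12)).  `[Balaban1985Averaging]` (CMP **98**) (15)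
p. 19.  Pages held: `paper:balaban1985-cmp99-background-propagators` pp. 392–395, 418–427.

WHY THIS FILE (director-ym №375 RULING, R2-A ORDER step (3); def-Y memo `pub-ymgap-node00-def-Y/R2-REPIN-DESIGN.md` v3).  Every v ≤ 9 record of
Node 00 builds its `Q`-dependent letters over the straight-contour pair `(QY parB, QsY parB)` of (3.12)–(3.13) (`deltaAY ∕ GAY` in `OpsYDeltaA`,
`deltaPiAY ∕ GDY ∕ QGQY ∕ QGQinvY ∕ HDY` in `B9Eq3132SectDLetters`, `deltaOneY ∕ G1Y ∕ QG1QinvY ∕ H1Y ∕ frakPY ∕ GGY` in `OpsYSectDE`, `GAv4Y ∕ KdiffSY`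
in `OpsYRecordV4`).  The certificate's rows 20–21 need the constraint letter of (3.110) to be the KNIT average `Q̄` of (3.115) (dag-n06-l's `QknitY`,
def-Y's `OpsYQLetter.qKnitOfRecord`), for which `hZ : Q̄DΓR = 0` is a theorem (n06-l) while for the straight-contour `Q` it is inhabitable only at
`U = 1` (def-Y located fact, memo §1).  THIS FILE rebuilds the nine letters over an ARBITRARY pair `𝔮 : CfgY → (fine-bond fns →ₗ coarse-bond fns)`,
`𝔮⋆` (reverse) — §1 at an index, with the `rfl` faces `…Q_QY : letterQ (QY parB) (QsY parB) = letter parB` recovering every v ≤ 9 letter; §2 the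
algebra that does not see which `𝔮` (`G̃⁻¹G̃ = 1`, `𝔮H = 1`, `𝔮H₁ = 1`, (3.153) expanded); §3 the `U = 1` clause `GA_one` for a FLAT pair (`𝔮(1) = Q♯`,
`𝔮⋆(1) = Q*♯` — laws (L1)∕(L1*) of `OpsYQLetter`); §4 the record update `CovLettersY.withQ 𝔏 𝔮 𝔮⋆ h h⋆ Gp′ Δ2` over an INDEX-LEVEL family
(`𝔮 x.toKIdx` for `Ω`, `𝔮 x.snd` for Thm 3.14's `Ω′`) and def-Y's v10 family `covLettersY_v10 𝔮 𝔮⋆ h h⋆ 𝔯 := (covLettersY_v4 𝔯).withQ …` with the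
face `covLettersY_v10 (QY · parBY ·) (QsY · parBY ·) … 𝔯 = covLettersY_v4P 𝔯` (`rfl`): the v10 chain at the straight-contour pair IS the v4P chain.
The SITE transporter of the composites is the base record's `parS` field (here `parSymY`); a record at another site transporter (e.g. the knit's
`parKnitY`) is obtained by applying `withQ` to a base family with that `parS` — def-Y's Q5 to dag-n06-d (bus, 2026-08-30).

SCOPE: DEFINITIONS + `rfl` faces + ring algebra + one `U = 1` clause.  No estimate; (L6)∕(L8) for the knit pair are dag-n06-l's items; O5 ∕ N06 are
NOT discharged here; count-neutral.
-/

namespace Literature.MathematicalPhysics.QuantumFieldTheory.Balaban1983to89.Node00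

open B6KLevelCensusIndexV1 (KIdx)
open B9PinMembersKLevelV1 (MemberY)
open B6Ineq2133TwoScaleV1 (onFun)
open B6SectAVectorModelV1 (deltaAE)
open B6GlobalChartV1 (domT)
open B6Prop26Census2136KLevelV1 (Gop)
open B9Cor35AtOneInverseLetters (GA_one_of_ringInverse_deltaA_one)
open B9Eq3132SectDLetters (gaugePiY gaugePiTY deltaPiY deltaPiAY GDY QGQY QGQinvY HDY withSectD)
open scoped Matrix

noncomputable section

variable {d ℓ : ℕ} {hd : 1 ≤ d + 1} {hL : Odd (ℓ + 1) ∧ 1 < ℓ + 1} {b₀ b₁ : ℝ} {Mstar : ℕ}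
variable {𝔸 : Type} [NormedRing 𝔸] [NormedAlgebra ℂ 𝔸] [CompleteSpace 𝔸]

/-! ## §1 The nine `Q`-dependent letters over a generic pair `(𝔮, 𝔮⋆)` at an index, and their `rfl` faces at the straight-contour pair -/

section Letters

variable (i : KIdx d ℓ hd hL b₀ b₁)

/-- **`Δ_a[𝔮](U) := Δ(U) + D_U R(U) D*_U + 𝔮⋆(U) a 𝔮(U)` — (3.26) over a generic averaging pair.** [cite: Balaban1985BackgroundPropagators, (3.26) p.395] -/
def deltaAQY (𝔮 : CfgY 𝔸 i → ((FBondY i → 𝔸) →ₗ[ℂ] (IBondY i → 𝔸))) (𝔮s : CfgY 𝔸 i → ((IBondY i → 𝔸) →ₗ[ℂ] (FBondY i → 𝔸)))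
    (parS : SiteParY 𝔸 i) (Gp : SiteOpY 𝔸 i) (U : CfgY 𝔸 i) : (FBondY i → 𝔸) →ₗ[ℂ] (FBondY i → 𝔸) :=
  hessY i U + gradY i U ∘ₗ RY i parS Gp U ∘ₗ divY i U + 𝔮s U ∘ₗ aY i ∘ₗ 𝔮 U

/-- **`G[𝔮](U) := Δ_a[𝔮](U)⁻¹` — (3.27)** (`Ring.inverse`, total). [cite: Balaban1985BackgroundPropagators, (3.27) p.395] -/
def GAQY (𝔮 : CfgY 𝔸 i → ((FBondY i → 𝔸) →ₗ[ℂ] (IBondY i → 𝔸))) (𝔮s : CfgY 𝔸 i → ((IBondY i → 𝔸) →ₗ[ℂ] (FBondY i → 𝔸)))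
    (parS : SiteParY 𝔸 i) (Gp : SiteOpY 𝔸 i) : BondOpY 𝔸 i :=
  fun U => Ring.inverse (deltaAQY i 𝔮 𝔮s parS Gp U)

/-- **`G̃⁻¹[𝔮](U) := Δ_π(U) + D_U R(U) D*_U + 𝔮⋆(U) a 𝔮(U)` — (3.122).** [cite: Balaban1985BackgroundPropagators, (3.122) p.420] -/
def deltaPiAQY (𝔮 : CfgY 𝔸 i → ((FBondY i → 𝔸) →ₗ[ℂ] (IBondY i → 𝔸))) (𝔮s : CfgY 𝔸 i → ((IBondY i → 𝔸) →ₗ[ℂ] (FBondY i → 𝔸)))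
    (parS : SiteParY 𝔸 i) (Gp : SiteOpY 𝔸 i) (U : CfgY 𝔸 i) : (FBondY i → 𝔸) →ₗ[ℂ] (FBondY i → 𝔸) :=
  deltaPiY i parS Gp U + gradY i U ∘ₗ RY i parS Gp U ∘ₗ divY i U + 𝔮s U ∘ₗ aY i ∘ₗ 𝔮 U

/-- **`G̃[𝔮](U)` — Sect. D's `G` (3.122)–(3.123)** (`Ring.inverse`). [cite: Balaban1985BackgroundPropagators, (3.122)–(3.123) p.420] -/
def GDQY (𝔮 : CfgY 𝔸 i → ((FBondY i → 𝔸) →ₗ[ℂ] (IBondY i → 𝔸))) (𝔮s : CfgY 𝔸 i → ((IBondY i → 𝔸) →ₗ[ℂ] (FBondY i → 𝔸)))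
    (parS : SiteParY 𝔸 i) (Gp : SiteOpY 𝔸 i) : BondOpY 𝔸 i :=
  fun U => Ring.inverse (deltaPiAQY i 𝔮 𝔮s parS Gp U)

/-- `𝔮(U) G(U) 𝔮⋆(U)` for a bond-sector letter `G`. [cite: Balaban1985BackgroundPropagators, (3.132) p.422] -/
def QGQOfQY (𝔮 : CfgY 𝔸 i → ((FBondY i → 𝔸) →ₗ[ℂ] (IBondY i → 𝔸))) (𝔮s : CfgY 𝔸 i → ((IBondY i → 𝔸) →ₗ[ℂ] (FBondY i → 𝔸)))
    (G : BondOpY 𝔸 i) (U : CfgY 𝔸 i) : (IBondY i → 𝔸) →ₗ[ℂ] (IBondY i → 𝔸) :=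
  𝔮 U ∘ₗ G U ∘ₗ 𝔮s U

/-- `(𝔮 G 𝔮⋆)⁻¹(U)` (`Ring.inverse`) for a bond-sector letter `G`. [cite: Balaban1985BackgroundPropagators, (3.132) p.422] -/
def QGQinvOfQY (𝔮 : CfgY 𝔸 i → ((FBondY i → 𝔸) →ₗ[ℂ] (IBondY i → 𝔸))) (𝔮s : CfgY 𝔸 i → ((IBondY i → 𝔸) →ₗ[ℂ] (FBondY i → 𝔸)))
    (G : BondOpY 𝔸 i) (U : CfgY 𝔸 i) : (IBondY i → 𝔸) →ₗ[ℂ] (IBondY i → 𝔸) :=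
  Ring.inverse (QGQOfQY i 𝔮 𝔮s G U)

/-- `H[𝔮] := G 𝔮⋆ (𝔮 G 𝔮⋆)⁻¹` — the minimizer map for the letter `G`. [cite: Balaban1985BackgroundPropagators, (3.123)–(3.126) pp.420–421] -/
def HOfQY (𝔮 : CfgY 𝔸 i → ((FBondY i → 𝔸) →ₗ[ℂ] (IBondY i → 𝔸))) (𝔮s : CfgY 𝔸 i → ((IBondY i → 𝔸) →ₗ[ℂ] (FBondY i → 𝔸)))
    (G : BondOpY 𝔸 i) (U : CfgY 𝔸 i) : (IBondY i → 𝔸) →ₗ[ℂ] (FBondY i → 𝔸) :=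
  G U ∘ₗ 𝔮s U ∘ₗ QGQinvOfQY i 𝔮 𝔮s G U

/-- **`(𝔮 G̃ 𝔮⋆)(U)`** — the operator of «QG̃Q*ω = B» (3.123). [cite: Balaban1985BackgroundPropagators, (3.123) p.420] -/
def QGQQY (𝔮 : CfgY 𝔸 i → ((FBondY i → 𝔸) →ₗ[ℂ] (IBondY i → 𝔸))) (𝔮s : CfgY 𝔸 i → ((IBondY i → 𝔸) →ₗ[ℂ] (FBondY i → 𝔸)))
    (parS : SiteParY 𝔸 i) (Gp : SiteOpY 𝔸 i) (U : CfgY 𝔸 i) : (IBondY i → 𝔸) →ₗ[ℂ] (IBondY i → 𝔸) :=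
  𝔮 U ∘ₗ GDQY i 𝔮 𝔮s parS Gp U ∘ₗ 𝔮s U

/-- **`(𝔮 G̃ 𝔮⋆)⁻¹(U)` — the `QGQinv` letter (3.123)∕(3.132).** [cite: Balaban1985BackgroundPropagators, (3.123) p.420, (3.132) p.422] -/
def QGQinvQY (𝔮 : CfgY 𝔸 i → ((FBondY i → 𝔸) →ₗ[ℂ] (IBondY i → 𝔸))) (𝔮s : CfgY 𝔸 i → ((IBondY i → 𝔸) →ₗ[ℂ] (FBondY i → 𝔸)))
    (parS : SiteParY 𝔸 i) (Gp : SiteOpY 𝔸 i) (U : CfgY 𝔸 i) : (IBondY i → 𝔸) →ₗ[ℂ] (IBondY i → 𝔸) :=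
  Ring.inverse (QGQQY i 𝔮 𝔮s parS Gp U)

/-- **`H[𝔮](U) := G̃(U) 𝔮⋆(U) (𝔮G̃𝔮⋆)⁻¹(U)` — (3.126).** [cite: Balaban1985BackgroundPropagators, (3.126) p.420] -/
def HDQY (𝔮 : CfgY 𝔸 i → ((FBondY i → 𝔸) →ₗ[ℂ] (IBondY i → 𝔸))) (𝔮s : CfgY 𝔸 i → ((IBondY i → 𝔸) →ₗ[ℂ] (FBondY i → 𝔸)))
    (parS : SiteParY 𝔸 i) (Gp : SiteOpY 𝔸 i) (U : CfgY 𝔸 i) : (IBondY i → 𝔸) →ₗ[ℂ] (FBondY i → 𝔸) :=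
  GDQY i 𝔮 𝔮s parS Gp U ∘ₗ 𝔮s U ∘ₗ QGQinvQY i 𝔮 𝔮s parS Gp U

/-- **`G₁⁻¹[𝔮](U) := G̃⁻¹[𝔮] − Δ⁽²⁾_π` — (3.128) after (3.134).** [cite: Balaban1985BackgroundPropagators, (3.128) p.421, (3.134) p.422] -/
def deltaOneQY (𝔮 : CfgY 𝔸 i → ((FBondY i → 𝔸) →ₗ[ℂ] (IBondY i → 𝔸))) (𝔮s : CfgY 𝔸 i → ((IBondY i → 𝔸) →ₗ[ℂ] (FBondY i → 𝔸)))
    (parS : SiteParY 𝔸 i) (Gp : SiteOpY 𝔸 i) (Δ2 : BondOpY 𝔸 i) (U : CfgY 𝔸 i) : (FBondY i → 𝔸) →ₗ[ℂ] (FBondY i → 𝔸) :=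
  deltaPiAQY i 𝔮 𝔮s parS Gp U - delta2PiY i parS Gp Δ2 U

/-- **`G₁[𝔮](U)` — (3.128)–(3.129)** (`Ring.inverse`). [cite: Balaban1985BackgroundPropagators, (3.128)–(3.129) p.421, (3.138) p.423] -/
def G1QY (𝔮 : CfgY 𝔸 i → ((FBondY i → 𝔸) →ₗ[ℂ] (IBondY i → 𝔸))) (𝔮s : CfgY 𝔸 i → ((IBondY i → 𝔸) →ₗ[ℂ] (FBondY i → 𝔸)))
    (parS : SiteParY 𝔸 i) (Gp : SiteOpY 𝔸 i) (Δ2 : BondOpY 𝔸 i) : BondOpY 𝔸 i :=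
  fun U => Ring.inverse (deltaOneQY i 𝔮 𝔮s parS Gp Δ2 U)

/-- **`(𝔮 G₁ 𝔮⋆)⁻¹(U)` — the `QG1Qinv` letter of (3.132).** [cite: Balaban1985BackgroundPropagators, (3.132) p.422] -/
def QG1QinvQY (𝔮 : CfgY 𝔸 i → ((FBondY i → 𝔸) →ₗ[ℂ] (IBondY i → 𝔸))) (𝔮s : CfgY 𝔸 i → ((IBondY i → 𝔸) →ₗ[ℂ] (FBondY i → 𝔸)))
    (parS : SiteParY 𝔸 i) (Gp : SiteOpY 𝔸 i) (Δ2 : BondOpY 𝔸 i) : CfgY 𝔸 i → (IBondY i → 𝔸) →ₗ[ℂ] (IBondY i → 𝔸) :=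
  QGQinvOfQY i 𝔮 𝔮s (G1QY i 𝔮 𝔮s parS Gp Δ2)

/-- **`H₁[𝔮](U) = G₁𝔮⋆(𝔮G₁𝔮⋆)⁻¹` — (3.129).** [cite: Balaban1985BackgroundPropagators, (3.129) p.421] -/
def H1QY (𝔮 : CfgY 𝔸 i → ((FBondY i → 𝔸) →ₗ[ℂ] (IBondY i → 𝔸))) (𝔮s : CfgY 𝔸 i → ((IBondY i → 𝔸) →ₗ[ℂ] (FBondY i → 𝔸)))
    (parS : SiteParY 𝔸 i) (Gp : SiteOpY 𝔸 i) (Δ2 : BondOpY 𝔸 i) : CfgY 𝔸 i → (IBondY i → 𝔸) →ₗ[ℂ] (FBondY i → 𝔸) :=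
  HOfQY i 𝔮 𝔮s (G1QY i 𝔮 𝔮s parS Gp Δ2)

/-- `𝔓[𝔮] := I − G₁𝔮⋆(𝔮G₁𝔮⋆)⁻¹𝔮 − G₁DRD*` of (3.147). [cite: Balaban1985BackgroundPropagators, (3.147) p.425] -/
def frakPQY (𝔮 : CfgY 𝔸 i → ((FBondY i → 𝔸) →ₗ[ℂ] (IBondY i → 𝔸))) (𝔮s : CfgY 𝔸 i → ((IBondY i → 𝔸) →ₗ[ℂ] (FBondY i → 𝔸)))
    (parS : SiteParY 𝔸 i) (Gp : SiteOpY 𝔸 i) (Δ2 : BondOpY 𝔸 i) (U : CfgY 𝔸 i) : (FBondY i → 𝔸) →ₗ[ℂ] (FBondY i → 𝔸) :=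
  LinearMap.id - G1QY i 𝔮 𝔮s parS Gp Δ2 U ∘ₗ 𝔮s U ∘ₗ QG1QinvQY i 𝔮 𝔮s parS Gp Δ2 U ∘ₗ 𝔮 U
    - G1QY i 𝔮 𝔮s parS Gp Δ2 U ∘ₗ gradY i U ∘ₗ RY i parS Gp U ∘ₗ divY i U

/-- **`𝔊[𝔮] := 𝔓 G₁` — the `GG` letter of (3.145) ∕ (3.153).** [cite: Balaban1985BackgroundPropagators, (3.145) p.424, (3.153) p.426] -/
def GGQY (𝔮 : CfgY 𝔸 i → ((FBondY i → 𝔸) →ₗ[ℂ] (IBondY i → 𝔸))) (𝔮s : CfgY 𝔸 i → ((IBondY i → 𝔸) →ₗ[ℂ] (FBondY i → 𝔸)))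
    (parS : SiteParY 𝔸 i) (Gp : SiteOpY 𝔸 i) (Δ2 : BondOpY 𝔸 i) : BondOpY 𝔸 i :=
  fun U => frakPQY i 𝔮 𝔮s parS Gp Δ2 U ∘ₗ G1QY i 𝔮 𝔮s parS Gp Δ2 U

variable {i}
variable (parS : SiteParY 𝔸 i) (parB : BondParY 𝔸 i) (Gp : SiteOpY 𝔸 i) (Δ2 G : BondOpY 𝔸 i)

/-- FACE: at the straight-contour pair, `Δ_a[Q] = Δ_a` (3.26) of `OpsYDeltaA` (`rfl`). [cite: Balaban1985BackgroundPropagators, (3.26) p.395, bookkeeping] -/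
theorem deltaAQY_QY : deltaAQY i (QY i parB) (QsY i parB) parS Gp = deltaAY i parS parB Gp := rfl
/-- FACE: `G[Q] = GAY` (3.27) (`rfl`). [cite: Balaban1985BackgroundPropagators, (3.27) p.395, bookkeeping] -/
theorem GAQY_QY : GAQY i (QY i parB) (QsY i parB) parS Gp = GAY i parS parB Gp := rfl
/-- FACE: `G̃⁻¹[Q] = deltaPiAY` (3.122) (`rfl`). [cite: Balaban1985BackgroundPropagators, (3.122) p.420, bookkeeping] -/
theorem deltaPiAQY_QY : deltaPiAQY i (QY i parB) (QsY i parB) parS Gp = deltaPiAY i parS parB Gp := rfl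
/-- FACE: `G̃[Q] = GDY` (`rfl`). [cite: Balaban1985BackgroundPropagators, (3.122)–(3.123) p.420, bookkeeping] -/
theorem GDQY_QY : GDQY i (QY i parB) (QsY i parB) parS Gp = GDY i parS parB Gp := rfl
/-- FACE: `QGQOf[Q] = QGQOfY` (`rfl`). [cite: Balaban1985BackgroundPropagators, (3.132) p.422, bookkeeping] -/
theorem QGQOfQY_QY : QGQOfQY i (QY i parB) (QsY i parB) G = QGQOfY i parB G := rfl
/-- FACE: `QGQinvOf[Q] = QGQinvOfY` (`rfl`). [cite: Balaban1985BackgroundPropagators, (3.132) p.422, bookkeeping] -/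
theorem QGQinvOfQY_QY : QGQinvOfQY i (QY i parB) (QsY i parB) G = QGQinvOfY i parB G := rfl
/-- FACE: `HOf[Q] = HOfY` (`rfl`). [cite: Balaban1985BackgroundPropagators, (3.126) p.420, bookkeeping] -/
theorem HOfQY_QY : HOfQY i (QY i parB) (QsY i parB) G = HOfY i parB G := rfl
/-- FACE: `(QG̃Q*)[Q] = QGQY` (`rfl`). [cite: Balaban1985BackgroundPropagators, (3.123) p.420, bookkeeping] -/
theorem QGQQY_QY : QGQQY i (QY i parB) (QsY i parB) parS Gp = QGQY i parS parB Gp := rfl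
/-- FACE: `(QG̃Q*)⁻¹[Q] = QGQinvY` (`rfl`). [cite: Balaban1985BackgroundPropagators, (3.132) p.422, bookkeeping] -/
theorem QGQinvQY_QY : QGQinvQY i (QY i parB) (QsY i parB) parS Gp = QGQinvY i parS parB Gp := rfl
/-- FACE: `H[Q] = HDY` (3.126) (`rfl`). [cite: Balaban1985BackgroundPropagators, (3.126) p.420, bookkeeping] -/
theorem HDQY_QY : HDQY i (QY i parB) (QsY i parB) parS Gp = HDY i parS parB Gp := rfl
/-- FACE: `G₁⁻¹[Q] = deltaOneY` (`rfl`). [cite: Balaban1985BackgroundPropagators, (3.128) p.421, bookkeeping] -/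
theorem deltaOneQY_QY : deltaOneQY i (QY i parB) (QsY i parB) parS Gp Δ2 = deltaOneY i parS parB Gp Δ2 := rfl
/-- FACE: `G₁[Q] = G1Y` (`rfl`). [cite: Balaban1985BackgroundPropagators, (3.128)–(3.129) p.421, bookkeeping] -/
theorem G1QY_QY : G1QY i (QY i parB) (QsY i parB) parS Gp Δ2 = G1Y i parS parB Gp Δ2 := rfl
/-- FACE: `(QG₁Q*)⁻¹[Q] = QG1QinvY` (`rfl`). [cite: Balaban1985BackgroundPropagators, (3.132) p.422, bookkeeping] -/
theorem QG1QinvQY_QY : QG1QinvQY i (QY i parB) (QsY i parB) parS Gp Δ2 = QG1QinvY i parS parB Gp Δ2 := rfl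
/-- FACE: `H₁[Q] = H1Y` (`rfl`). [cite: Balaban1985BackgroundPropagators, (3.129) p.421, bookkeeping] -/
theorem H1QY_QY : H1QY i (QY i parB) (QsY i parB) parS Gp Δ2 = H1Y i parS parB Gp Δ2 := rfl
/-- FACE: `𝔓[Q] = frakPY` (`rfl`). [cite: Balaban1985BackgroundPropagators, (3.147) p.425, bookkeeping] -/
theorem frakPQY_QY : frakPQY i (QY i parB) (QsY i parB) parS Gp Δ2 = frakPY i parS parB Gp Δ2 := rfl
/-- FACE: `𝔊[Q] = GGY` (`rfl`). [cite: Balaban1985BackgroundPropagators, (3.153) p.426, bookkeeping] -/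
theorem GGQY_QY : GGQY i (QY i parB) (QsY i parB) parS Gp Δ2 = GGY i parS parB Gp Δ2 := rfl

end Letters

/-! ## §2 The algebra that does not see which `𝔮`: inverses, `𝔮H = 1`, `𝔮H₁ = 1`, (3.153) expanded -/

section Algebra

variable {i : KIdx d ℓ hd hL b₀ b₁}
variable {𝔮 : CfgY 𝔸 i → ((FBondY i → 𝔸) →ₗ[ℂ] (IBondY i → 𝔸))} {𝔮s : CfgY 𝔸 i → ((IBondY i → 𝔸) →ₗ[ℂ] (FBondY i → 𝔸))}
variable {parS : SiteParY 𝔸 i} {Gp : SiteOpY 𝔸 i} {Δ2 G : BondOpY 𝔸 i} {U : CfgY 𝔸 i}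

/-- `G̃⁻¹[𝔮] = Δ_a[𝔮] − Δ′_π` (the step from `G₀` to `G` of (3.130)). [cite: Balaban1985BackgroundPropagators, (3.120) p.419, (3.130) p.421] -/
theorem deltaPiAQY_eq_deltaAQY_sub (𝔮 : CfgY 𝔸 i → ((FBondY i → 𝔸) →ₗ[ℂ] (IBondY i → 𝔸)))
    (𝔮s : CfgY 𝔸 i → ((IBondY i → 𝔸) →ₗ[ℂ] (FBondY i → 𝔸))) (parS : SiteParY 𝔸 i) (Gp : SiteOpY 𝔸 i) (U : CfgY 𝔸 i) :
    deltaPiAQY i 𝔮 𝔮s parS Gp U = deltaAQY i 𝔮 𝔮s parS Gp U - deltaPiPrimeY i parS Gp U := by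
  simp only [deltaPiAQY, deltaAQY, deltaPiPrimeY]
  abel

/-- `Δ_a[𝔮](U)·G[𝔮](U) = 1` wherever `Δ_a[𝔮](U)` is invertible. [cite: Balaban1985BackgroundPropagators, (3.27) p.395] -/
theorem deltaAQY_mul_GAQY (hU : IsUnit (deltaAQY i 𝔮 𝔮s parS Gp U)) : deltaAQY i 𝔮 𝔮s parS Gp U * GAQY i 𝔮 𝔮s parS Gp U = 1 :=
  Ring.mul_inverse_cancel _ hU

/-- `G[𝔮](U)·Δ_a[𝔮](U) = 1` wherever `Δ_a[𝔮](U)` is invertible. [cite: Balaban1985BackgroundPropagators, (3.27) p.395] -/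
theorem GAQY_mul_deltaAQY (hU : IsUnit (deltaAQY i 𝔮 𝔮s parS Gp U)) : GAQY i 𝔮 𝔮s parS Gp U * deltaAQY i 𝔮 𝔮s parS Gp U = 1 :=
  Ring.inverse_mul_cancel _ hU

/-- `G̃⁻¹[𝔮](U)·G̃[𝔮](U) = 1` wherever invertible. [cite: Balaban1985BackgroundPropagators, (3.122) p.420] -/
theorem deltaPiAQY_mul_GDQY (hU : IsUnit (deltaPiAQY i 𝔮 𝔮s parS Gp U)) : deltaPiAQY i 𝔮 𝔮s parS Gp U * GDQY i 𝔮 𝔮s parS Gp U = 1 :=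
  Ring.mul_inverse_cancel _ hU

/-- `G̃[𝔮](U)·G̃⁻¹[𝔮](U) = 1` wherever invertible. [cite: Balaban1985BackgroundPropagators, (3.122) p.420] -/
theorem GDQY_mul_deltaPiAQY (hU : IsUnit (deltaPiAQY i 𝔮 𝔮s parS Gp U)) : GDQY i 𝔮 𝔮s parS Gp U * deltaPiAQY i 𝔮 𝔮s parS Gp U = 1 :=
  Ring.inverse_mul_cancel _ hU

/-- `(𝔮G𝔮⋆)(U)·(𝔮G𝔮⋆)⁻¹(U) = 1` wherever invertible. [cite: Balaban1985BackgroundPropagators, (3.132) p.422] -/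
theorem QGQOfQY_mul_QGQinvOfQY (hU : IsUnit (QGQOfQY i 𝔮 𝔮s G U)) : QGQOfQY i 𝔮 𝔮s G U * QGQinvOfQY i 𝔮 𝔮s G U = 1 :=
  Ring.mul_inverse_cancel _ hU

/-- `(𝔮G𝔮⋆)⁻¹ = 0` off the invertibility locus (`Ring.inverse` convention). [cite: Balaban1985BackgroundPropagators, (3.132) p.422, bookkeeping] -/
theorem QGQinvOfQY_of_not_isUnit (hU : ¬IsUnit (QGQOfQY i 𝔮 𝔮s G U)) : QGQinvOfQY i 𝔮 𝔮s G U = 0 :=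
  Ring.inverse_non_unit _ hU

/-- ★ **`𝔮 H[𝔮] = 1`** wherever `𝔮G𝔮⋆` is invertible: «HB» satisfies the constraint `𝔮A = B` of (3.110). [cite: Balaban1985BackgroundPropagators, (3.123)–(3.126) pp.420–421] -/
theorem comp_HOfQY (hU : IsUnit (QGQOfQY i 𝔮 𝔮s G U)) : 𝔮 U ∘ₗ HOfQY i 𝔮 𝔮s G U = LinearMap.id := by
  rw [HOfQY, QGQinvOfQY, ← LinearMap.comp_assoc, ← LinearMap.comp_assoc]
  exact Ring.mul_inverse_cancel _ hU

/-- `(𝔮G̃𝔮⋆)(U)` is `QGQOf[𝔮]` at `G = G̃[𝔮]` (`rfl`). [cite: Balaban1985BackgroundPropagators, (3.123) p.420, bookkeeping] -/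
theorem QGQQY_eq_QGQOfQY (𝔮 : CfgY 𝔸 i → ((FBondY i → 𝔸) →ₗ[ℂ] (IBondY i → 𝔸)))
    (𝔮s : CfgY 𝔸 i → ((IBondY i → 𝔸) →ₗ[ℂ] (FBondY i → 𝔸))) (parS : SiteParY 𝔸 i) (Gp : SiteOpY 𝔸 i) (U : CfgY 𝔸 i) :
    QGQQY i 𝔮 𝔮s parS Gp U = QGQOfQY i 𝔮 𝔮s (GDQY i 𝔮 𝔮s parS Gp) U := rfl

/-- `(𝔮G̃𝔮⋆)⁻¹(U)` is `QGQinvOf[𝔮]` at `G = G̃[𝔮]` (`rfl`). [cite: Balaban1985BackgroundPropagators, (3.132) p.422, bookkeeping] -/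
theorem QGQinvQY_eq_QGQinvOfQY (𝔮 : CfgY 𝔸 i → ((FBondY i → 𝔸) →ₗ[ℂ] (IBondY i → 𝔸)))
    (𝔮s : CfgY 𝔸 i → ((IBondY i → 𝔸) →ₗ[ℂ] (FBondY i → 𝔸))) (parS : SiteParY 𝔸 i) (Gp : SiteOpY 𝔸 i) (U : CfgY 𝔸 i) :
    QGQinvQY i 𝔮 𝔮s parS Gp U = QGQinvOfQY i 𝔮 𝔮s (GDQY i 𝔮 𝔮s parS Gp) U := rfl

/-- `H[𝔮](U)` is `HOf[𝔮]` at `G = G̃[𝔮]` (`rfl`). [cite: Balaban1985BackgroundPropagators, (3.126) p.421, bookkeeping] -/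
theorem HDQY_eq_HOfQY (𝔮 : CfgY 𝔸 i → ((FBondY i → 𝔸) →ₗ[ℂ] (IBondY i → 𝔸)))
    (𝔮s : CfgY 𝔸 i → ((IBondY i → 𝔸) →ₗ[ℂ] (FBondY i → 𝔸))) (parS : SiteParY 𝔸 i) (Gp : SiteOpY 𝔸 i) (U : CfgY 𝔸 i) :
    HDQY i 𝔮 𝔮s parS Gp U = HOfQY i 𝔮 𝔮s (GDQY i 𝔮 𝔮s parS Gp) U := rfl

/-- ★ **`𝔮 H[𝔮] = 1` for Sect. D's `H` (3.126)** wherever `𝔮G̃𝔮⋆` is invertible. [cite: Balaban1985BackgroundPropagators, (3.126) p.421, (3.110) p.417] -/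
theorem comp_HDQY (hU : IsUnit (QGQQY i 𝔮 𝔮s parS Gp U)) : 𝔮 U ∘ₗ HDQY i 𝔮 𝔮s parS Gp U = LinearMap.id :=
  comp_HOfQY hU

/-- `G₁⁻¹[𝔮]·G₁[𝔮] = 1` wherever invertible. [cite: Balaban1985BackgroundPropagators, (3.128) p.421, (3.138) p.423] -/
theorem deltaOneQY_mul_G1QY (hU : IsUnit (deltaOneQY i 𝔮 𝔮s parS Gp Δ2 U)) :
    deltaOneQY i 𝔮 𝔮s parS Gp Δ2 U * G1QY i 𝔮 𝔮s parS Gp Δ2 U = 1 :=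
  Ring.mul_inverse_cancel _ hU

/-- `G₁[𝔮]·G₁⁻¹[𝔮] = 1` wherever invertible. [cite: Balaban1985BackgroundPropagators, (3.128) p.421, (3.138) p.423] -/
theorem G1QY_mul_deltaOneQY (hU : IsUnit (deltaOneQY i 𝔮 𝔮s parS Gp Δ2 U)) :
    G1QY i 𝔮 𝔮s parS Gp Δ2 U * deltaOneQY i 𝔮 𝔮s parS Gp Δ2 U = 1 :=
  Ring.inverse_mul_cancel _ hU

/-- ★ **`𝔮 H₁[𝔮] = 1`** wherever `𝔮G₁𝔮⋆` is invertible (3.129)∕(3.127). [cite: Balaban1985BackgroundPropagators, (3.129) p.421] -/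
theorem comp_H1QY (hU : IsUnit (QGQOfQY i 𝔮 𝔮s (G1QY i 𝔮 𝔮s parS Gp Δ2) U)) : 𝔮 U ∘ₗ H1QY i 𝔮 𝔮s parS Gp Δ2 U = LinearMap.id :=
  comp_HOfQY hU

/-- `G₁⁻¹[𝔮] = Δ_a[𝔮] − (Δ′_π + Δ⁽²⁾_π)` (the resolvent reading behind (3.138)). [cite: Balaban1985BackgroundPropagators, (3.138) p.423] -/
theorem deltaOneQY_eq_deltaAQY_sub (𝔮 : CfgY 𝔸 i → ((FBondY i → 𝔸) →ₗ[ℂ] (IBondY i → 𝔸)))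
    (𝔮s : CfgY 𝔸 i → ((IBondY i → 𝔸) →ₗ[ℂ] (FBondY i → 𝔸))) (parS : SiteParY 𝔸 i) (Gp : SiteOpY 𝔸 i) (Δ2 : BondOpY 𝔸 i) (U : CfgY 𝔸 i) :
    deltaOneQY i 𝔮 𝔮s parS Gp Δ2 U = deltaAQY i 𝔮 𝔮s parS Gp U - (deltaPiPrimeY i parS Gp U + delta2PiY i parS Gp Δ2 U) := by
  rw [deltaOneQY, deltaPiAQY_eq_deltaAQY_sub, sub_sub]

/-- `H₁[𝔮]` unfolded: `G₁𝔮⋆(𝔮G₁𝔮⋆)⁻¹`. [cite: Balaban1985BackgroundPropagators, (3.129) p.421, bookkeeping] -/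
theorem H1QY_eq (𝔮 : CfgY 𝔸 i → ((FBondY i → 𝔸) →ₗ[ℂ] (IBondY i → 𝔸)))
    (𝔮s : CfgY 𝔸 i → ((IBondY i → 𝔸) →ₗ[ℂ] (FBondY i → 𝔸))) (parS : SiteParY 𝔸 i) (Gp : SiteOpY 𝔸 i) (Δ2 : BondOpY 𝔸 i) (U : CfgY 𝔸 i) :
    H1QY i 𝔮 𝔮s parS Gp Δ2 U = G1QY i 𝔮 𝔮s parS Gp Δ2 U ∘ₗ 𝔮s U ∘ₗ QG1QinvQY i 𝔮 𝔮s parS Gp Δ2 U := rfl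

/-- ★ **(3.153) EXPANDED**: `𝔊[𝔮] = G₁ − G₁𝔮⋆(𝔮G₁𝔮⋆)⁻¹𝔮G₁ − G₁DRD*G₁`. [cite: Balaban1985BackgroundPropagators, (3.153) p.426] -/
theorem GGQY_eq_3153 (𝔮 : CfgY 𝔸 i → ((FBondY i → 𝔸) →ₗ[ℂ] (IBondY i → 𝔸)))
    (𝔮s : CfgY 𝔸 i → ((IBondY i → 𝔸) →ₗ[ℂ] (FBondY i → 𝔸))) (parS : SiteParY 𝔸 i) (Gp : SiteOpY 𝔸 i) (Δ2 : BondOpY 𝔸 i) (U : CfgY 𝔸 i) :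
    GGQY i 𝔮 𝔮s parS Gp Δ2 U = G1QY i 𝔮 𝔮s parS Gp Δ2 U
      - G1QY i 𝔮 𝔮s parS Gp Δ2 U ∘ₗ 𝔮s U ∘ₗ QG1QinvQY i 𝔮 𝔮s parS Gp Δ2 U ∘ₗ 𝔮 U ∘ₗ G1QY i 𝔮 𝔮s parS Gp Δ2 U
      - G1QY i 𝔮 𝔮s parS Gp Δ2 U ∘ₗ gradY i U ∘ₗ RY i parS Gp U ∘ₗ divY i U ∘ₗ G1QY i 𝔮 𝔮s parS Gp Δ2 U := by
  simp only [GGQY, frakPQY, LinearMap.sub_comp, LinearMap.id_comp, LinearMap.comp_assoc]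

end Algebra

/-! ## §3 At `U = 1` for a FLAT pair (`𝔮(1) = Q♯`, `𝔮⋆(1) = Q*♯`): `Δ_a[𝔮](1) = Δ_a♯`, so `G[𝔮](1) = Gop♯` — the clause `CovLettersY.GA_one` -/

section AtOne

variable (i : KIdx d ℓ hd hL b₀ b₁)
variable {𝔮 : CfgY 𝔸 i → ((FBondY i → 𝔸) →ₗ[ℂ] (IBondY i → 𝔸))} {𝔮s : CfgY 𝔸 i → ((IBondY i → 𝔸) →ₗ[ℂ] (FBondY i → 𝔸))}
variable {parS : SiteParY 𝔸 i} {Gp : SiteOpY 𝔸 i}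

/-- ★ **`Δ_a[𝔮](1)(A ⊗ E) = (Δ_a A) ⊗ E`** for a flat pair (print p. 395: «It coincides with Δ_a in (2.19) if U = 1»).
[cite: Balaban1985BackgroundPropagators, p.395, (3.26) p.395] -/
theorem deltaAQY_one_liftY (hparS : ∀ z w, parS (fun _ _ => 1) z w = 1) (h𝔮 : 𝔮 (fun _ _ => 1) = liftMatY 𝔸 (qK i))
    (h𝔮s : 𝔮s (fun _ _ => 1) = liftMatY 𝔸 (qsK i))
    (hGp : ∀ (f : SiteY i → ℝ) (E : 𝔸), Gp (fun _ _ => 1) (liftY f E) = liftY ((toKT i).G *ᵥ f) E) (A : FBondY i → ℝ) (E : 𝔸) :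
    deltaAQY i 𝔮 𝔮s parS Gp (fun _ _ => 1) (liftY A E) = liftY (onFun (deltaAE (domT i.hN i.D i.hk) i.cf i.w) A) E := by
  rw [← deltaAY_one_liftY i hparS (parBY_one i) hGp A E, deltaAQY, deltaAY, h𝔮, h𝔮s, QY_one i (parBY_one i), QsY_one i (parBY_one i)]

/-- ★ **THE CLAUSE `GA_one` FOR `G[𝔮] = Δ_a[𝔮]⁻¹`** of a flat pair: `G[𝔮](1)(J ⊗ E) = (Gop J) ⊗ E`. [cite: Balaban1985BackgroundPropagators, (3.27) p.395, Cor. 3.5 p.407] -/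
theorem GAQY_one_liftY (hparS : ∀ z w, parS (fun _ _ => 1) z w = 1) (h𝔮 : 𝔮 (fun _ _ => 1) = liftMatY 𝔸 (qK i))
    (h𝔮s : 𝔮s (fun _ _ => 1) = liftMatY 𝔸 (qsK i))
    (hGp : ∀ (f : SiteY i → ℝ) (E : 𝔸), Gp (fun _ _ => 1) (liftY f E) = liftY ((toKT i).G *ᵥ f) E) (J : FBondY i → ℝ) (E : 𝔸) :
    GAQY i 𝔮 𝔮s parS Gp (fun _ _ => 1) (liftY J E) = liftY (Gop i J) E :=
  GA_one_of_ringInverse_deltaA_one i (GAQY i 𝔮 𝔮s parS Gp) (deltaAQY i 𝔮 𝔮s parS Gp) rfl (deltaAQY_one_liftY i hparS h𝔮 h𝔮s hGp) J E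

/-- `Δ_a[𝔮](1) = Δ_a(1)` of the straight-contour pair, for a flat pair. [cite: Balaban1985BackgroundPropagators, p.395, bookkeeping] -/
theorem deltaAQY_one_eq (h𝔮 : 𝔮 (fun _ _ => 1) = liftMatY 𝔸 (qK i)) (h𝔮s : 𝔮s (fun _ _ => 1) = liftMatY 𝔸 (qsK i)) :
    deltaAQY i 𝔮 𝔮s parS Gp (fun _ _ => 1) = deltaAY i parS (parBY i) Gp (fun _ _ => 1) := by
  rw [deltaAQY, deltaAY, h𝔮, h𝔮s, QY_one i (parBY_one i), QsY_one i (parBY_one i)]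

/-- `G̃⁻¹[𝔮](1) = G̃⁻¹(1)` of the straight-contour pair, for a flat pair. [cite: Balaban1985BackgroundPropagators, (3.122) p.420, bookkeeping] -/
theorem deltaPiAQY_one_eq (h𝔮 : 𝔮 (fun _ _ => 1) = liftMatY 𝔸 (qK i)) (h𝔮s : 𝔮s (fun _ _ => 1) = liftMatY 𝔸 (qsK i)) :
    deltaPiAQY i 𝔮 𝔮s parS Gp (fun _ _ => 1) = deltaPiAY i parS (parBY i) Gp (fun _ _ => 1) := by
  rw [deltaPiAQY, deltaPiAY, h𝔮, h𝔮s, QY_one i (parBY_one i), QsY_one i (parBY_one i)]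

/-- `G[𝔮](1) = G(1)`, for a flat pair. [cite: Balaban1985BackgroundPropagators, (3.27) p.395, bookkeeping] -/
theorem GAQY_one_eq (h𝔮 : 𝔮 (fun _ _ => 1) = liftMatY 𝔸 (qK i)) (h𝔮s : 𝔮s (fun _ _ => 1) = liftMatY 𝔸 (qsK i)) :
    GAQY i 𝔮 𝔮s parS Gp (fun _ _ => 1) = GAY i parS (parBY i) Gp (fun _ _ => 1) := by
  simp only [GAQY, GAY, deltaAQY_one_eq i h𝔮 h𝔮s]

/-- `G̃[𝔮](1) = G̃(1)`, for a flat pair. [cite: Balaban1985BackgroundPropagators, (3.122) p.420, bookkeeping] -/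
theorem GDQY_one_eq (h𝔮 : 𝔮 (fun _ _ => 1) = liftMatY 𝔸 (qK i)) (h𝔮s : 𝔮s (fun _ _ => 1) = liftMatY 𝔸 (qsK i)) :
    GDQY i 𝔮 𝔮s parS Gp (fun _ _ => 1) = GDY i parS (parBY i) Gp (fun _ _ => 1) := by
  simp only [GDQY, GDY, deltaPiAQY_one_eq i h𝔮 h𝔮s]

end AtOne

/-! ## §4 The record update `CovLettersY.withQ` over an index-level pair family, and def-Y's v10 family -/

section Upgrade

variable (𝔸) {x : MemberY d ℓ hd hL b₀ b₁ Mstar}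

/-- `G[𝔮](Ω′, U)`: the (3.27) letter over the pair at the member's SECOND-sequence index `x.snd` (same torus, `k`, `M`, units — its carriers are the
member's, definitionally; cf. `GAsndSY`), fed a site transporter ∕ site propagator at `x.snd`. [cite: Balaban1985BackgroundPropagators, Thm 3.14 pp.426–427] -/
def GAsndQY (x : MemberY d ℓ hd hL b₀ b₁ Mstar) (𝔮 : ∀ i : KIdx d ℓ hd hL b₀ b₁, CfgY 𝔸 i → ((FBondY i → 𝔸) →ₗ[ℂ] (IBondY i → 𝔸)))
    (𝔮s : ∀ i : KIdx d ℓ hd hL b₀ b₁, CfgY 𝔸 i → ((IBondY i → 𝔸) →ₗ[ℂ] (FBondY i → 𝔸)))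
    (parS' : SiteParY 𝔸 x.snd) (Gp'' : SiteOpY 𝔸 x.snd) : BondOpY 𝔸 x.toKIdx :=
  (GAQY x.snd (𝔮 x.snd) (𝔮s x.snd) parS' Gp'' : BondOpY 𝔸 x.snd)

/-- ★★ **REPLACING THE NINE `Q`-DEPENDENT LETTERS OF A RECORD BY THEIR `(𝔮, 𝔮⋆)`-VERSIONS**: `GA := G[𝔮 x.toKIdx]` over the record's `parS ∕ Gp`
(lattice units, as `withGAC`), `Kdiff := G[𝔮 x.toKIdx](Ω) − G[𝔮 x.snd](Ω′)` over a second-sequence base letter pair `(parS′, Gp″)` at `x.snd`, and the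
seven Sect. D∕E composites `GD, QGQinv, H, G₁, QG1Qinv, H₁, GG` over `(𝔮, 𝔮⋆)(x.toKIdx)` fed the site propagator `Gp′` and the residual letter `Δ2` (as
`withSectDEAt`); the clause `GA_one` from the flatness of the pair at `x.toKIdx`.  `𝔮` is an INDEX-level family (`OpsYQLetter.QFamY`-shaped).
[cite: Balaban1985BackgroundPropagators, (3.26)–(3.27) p.395, (3.122)–(3.132) pp.420–422, (3.153) p.426, (3.154) p.427] -/
def CovLettersY.withQ (𝔏 : CovLettersY 𝔸 x) (𝔮 : ∀ i : KIdx d ℓ hd hL b₀ b₁, CfgY 𝔸 i → ((FBondY i → 𝔸) →ₗ[ℂ] (IBondY i → 𝔸)))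
    (𝔮s : ∀ i : KIdx d ℓ hd hL b₀ b₁, CfgY 𝔸 i → ((IBondY i → 𝔸) →ₗ[ℂ] (FBondY i → 𝔸)))
    (h𝔮 : 𝔮 x.toKIdx (fun _ _ => 1) = liftMatY 𝔸 (qK x.toKIdx)) (h𝔮s : 𝔮s x.toKIdx (fun _ _ => 1) = liftMatY 𝔸 (qsK x.toKIdx))
    (parS' : SiteParY 𝔸 x.snd) (Gp'' : SiteOpY 𝔸 x.snd) (Gp' : SiteOpY 𝔸 x.toKIdx) (Δ2 : BondOpY 𝔸 x.toKIdx) : CovLettersY 𝔸 x :=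
  { 𝔏 with
    GA := GAQY x.toKIdx (𝔮 x.toKIdx) (𝔮s x.toKIdx) 𝔏.parS 𝔏.Gp
    Kdiff := fun U => GAQY x.toKIdx (𝔮 x.toKIdx) (𝔮s x.toKIdx) 𝔏.parS 𝔏.Gp U - GAsndQY 𝔸 x 𝔮 𝔮s parS' Gp'' U
    GD := GDQY x.toKIdx (𝔮 x.toKIdx) (𝔮s x.toKIdx) 𝔏.parS Gp'
    QGQinv := QGQinvQY x.toKIdx (𝔮 x.toKIdx) (𝔮s x.toKIdx) 𝔏.parS Gp'
    H := HDQY x.toKIdx (𝔮 x.toKIdx) (𝔮s x.toKIdx) 𝔏.parS Gp'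
    G₁ := G1QY x.toKIdx (𝔮 x.toKIdx) (𝔮s x.toKIdx) 𝔏.parS Gp' Δ2
    QG1Qinv := QG1QinvQY x.toKIdx (𝔮 x.toKIdx) (𝔮s x.toKIdx) 𝔏.parS Gp' Δ2
    H₁ := H1QY x.toKIdx (𝔮 x.toKIdx) (𝔮s x.toKIdx) 𝔏.parS Gp' Δ2
    GG := GGQY x.toKIdx (𝔮 x.toKIdx) (𝔮s x.toKIdx) 𝔏.parS Gp' Δ2
    GA_one := GAQY_one_liftY x.toKIdx 𝔏.parS_one h𝔮 h𝔮s 𝔏.Gp_one }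

variable {𝔸}
variable (𝔏 : CovLettersY 𝔸 x) (𝔮 : ∀ i : KIdx d ℓ hd hL b₀ b₁, CfgY 𝔸 i → ((FBondY i → 𝔸) →ₗ[ℂ] (IBondY i → 𝔸)))
  (𝔮s : ∀ i : KIdx d ℓ hd hL b₀ b₁, CfgY 𝔸 i → ((IBondY i → 𝔸) →ₗ[ℂ] (FBondY i → 𝔸)))
  (h𝔮 : 𝔮 x.toKIdx (fun _ _ => 1) = liftMatY 𝔸 (qK x.toKIdx)) (h𝔮s : 𝔮s x.toKIdx (fun _ _ => 1) = liftMatY 𝔸 (qsK x.toKIdx))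
  (parS' : SiteParY 𝔸 x.snd) (Gp'' : SiteOpY 𝔸 x.snd) (Gp' : SiteOpY 𝔸 x.toKIdx) (Δ2 : BondOpY 𝔸 x.toKIdx)

/-- the updated `GA = G[𝔮]`. [cite: Balaban1985BackgroundPropagators, (3.27) p.395, bookkeeping] -/
theorem CovLettersY.withQ_GA : (𝔏.withQ 𝔸 𝔮 𝔮s h𝔮 h𝔮s parS' Gp'' Gp' Δ2).GA = GAQY x.toKIdx (𝔮 x.toKIdx) (𝔮s x.toKIdx) 𝔏.parS 𝔏.Gp := rfl
/-- the updated `Kdiff = G[𝔮](Ω) − G[𝔮](Ω′)`. [cite: Balaban1985BackgroundPropagators, (3.154) p.427, bookkeeping] -/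
theorem CovLettersY.withQ_Kdiff : (𝔏.withQ 𝔸 𝔮 𝔮s h𝔮 h𝔮s parS' Gp'' Gp' Δ2).Kdiff = fun U =>
    GAQY x.toKIdx (𝔮 x.toKIdx) (𝔮s x.toKIdx) 𝔏.parS 𝔏.Gp U - GAsndQY 𝔸 x 𝔮 𝔮s parS' Gp'' U := rfl
/-- the updated `GD = G̃[𝔮]` fed `Gp′`. [cite: Balaban1985BackgroundPropagators, (3.122)–(3.123) p.420, bookkeeping] -/
theorem CovLettersY.withQ_GD : (𝔏.withQ 𝔸 𝔮 𝔮s h𝔮 h𝔮s parS' Gp'' Gp' Δ2).GD = GDQY x.toKIdx (𝔮 x.toKIdx) (𝔮s x.toKIdx) 𝔏.parS Gp' := rfl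
/-- the updated `QGQinv = (𝔮G̃𝔮⋆)⁻¹`. [cite: Balaban1985BackgroundPropagators, (3.132) p.422, bookkeeping] -/
theorem CovLettersY.withQ_QGQinv :
    (𝔏.withQ 𝔸 𝔮 𝔮s h𝔮 h𝔮s parS' Gp'' Gp' Δ2).QGQinv = QGQinvQY x.toKIdx (𝔮 x.toKIdx) (𝔮s x.toKIdx) 𝔏.parS Gp' := rfl
/-- the updated `H = H[𝔮]` (3.126). [cite: Balaban1985BackgroundPropagators, (3.126) p.420, bookkeeping] -/
theorem CovLettersY.withQ_H : (𝔏.withQ 𝔸 𝔮 𝔮s h𝔮 h𝔮s parS' Gp'' Gp' Δ2).H = HDQY x.toKIdx (𝔮 x.toKIdx) (𝔮s x.toKIdx) 𝔏.parS Gp' := rfl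
/-- the updated `G₁ = G₁[𝔮]`. [cite: Balaban1985BackgroundPropagators, (3.128)–(3.129) p.421, bookkeeping] -/
theorem CovLettersY.withQ_G₁ : (𝔏.withQ 𝔸 𝔮 𝔮s h𝔮 h𝔮s parS' Gp'' Gp' Δ2).G₁ = G1QY x.toKIdx (𝔮 x.toKIdx) (𝔮s x.toKIdx) 𝔏.parS Gp' Δ2 := rfl
/-- the updated `QG1Qinv = (𝔮G₁𝔮⋆)⁻¹`. [cite: Balaban1985BackgroundPropagators, (3.132) p.422, bookkeeping] -/
theorem CovLettersY.withQ_QG1Qinv :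
    (𝔏.withQ 𝔸 𝔮 𝔮s h𝔮 h𝔮s parS' Gp'' Gp' Δ2).QG1Qinv = QG1QinvQY x.toKIdx (𝔮 x.toKIdx) (𝔮s x.toKIdx) 𝔏.parS Gp' Δ2 := rfl
/-- the updated `H₁ = H₁[𝔮]`. [cite: Balaban1985BackgroundPropagators, (3.129) p.421, bookkeeping] -/
theorem CovLettersY.withQ_H₁ : (𝔏.withQ 𝔸 𝔮 𝔮s h𝔮 h𝔮s parS' Gp'' Gp' Δ2).H₁ = H1QY x.toKIdx (𝔮 x.toKIdx) (𝔮s x.toKIdx) 𝔏.parS Gp' Δ2 := rfl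
/-- the updated `GG = 𝔊[𝔮]`. [cite: Balaban1985BackgroundPropagators, (3.153) p.426, bookkeeping] -/
theorem CovLettersY.withQ_GG : (𝔏.withQ 𝔸 𝔮 𝔮s h𝔮 h𝔮s parS' Gp'' Gp' Δ2).GG = GGQY x.toKIdx (𝔮 x.toKIdx) (𝔮s x.toKIdx) 𝔏.parS Gp' Δ2 := rfl
/-- the update keeps `G′`. [cite: Balaban1985BackgroundPropagators, (3.25) p.395, bookkeeping] -/
theorem CovLettersY.withQ_Gp : (𝔏.withQ 𝔸 𝔮 𝔮s h𝔮 h𝔮s parS' Gp'' Gp' Δ2).Gp = 𝔏.Gp := rfl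
/-- the update keeps `C`. [cite: Balaban1985BackgroundPropagators, (3.48) p.398, bookkeeping] -/
theorem CovLettersY.withQ_C : (𝔏.withQ 𝔸 𝔮 𝔮s h𝔮 h𝔮s parS' Gp'' Gp' Δ2).C = 𝔏.C := rfl
/-- the update keeps the site transporter. [cite: Balaban1985BackgroundPropagators, (3.40) p.397, bookkeeping] -/
theorem CovLettersY.withQ_parS : (𝔏.withQ 𝔸 𝔮 𝔮s h𝔮 h𝔮s parS' Gp'' Gp' Δ2).parS = 𝔏.parS := rfl
/-- the update keeps the bond transporter (the kernel READERS' transporter; the averaging letter is `𝔮`). [cite: Balaban1985BackgroundPropagators, (3.40) p.397, bookkeeping] -/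
theorem CovLettersY.withQ_parB : (𝔏.withQ 𝔸 𝔮 𝔮s h𝔮 h𝔮s parS' Gp'' Gp' Δ2).parB = 𝔏.parB := rfl
/-- the update keeps `P349`. [cite: Balaban1985BackgroundPropagators, (3.49) p.399, bookkeeping] -/
theorem CovLettersY.withQ_P349 : (𝔏.withQ 𝔸 𝔮 𝔮s h𝔮 h𝔮s parS' Gp'' Gp' Δ2).P349 = 𝔏.P349 := rfl
/-- the update keeps `Ck`. [cite: Balaban1985BackgroundPropagators, (3.187) p.432, bookkeeping] -/
theorem CovLettersY.withQ_Ck : (𝔏.withQ 𝔸 𝔮 𝔮s h𝔮 h𝔮s parS' Gp'' Gp' Δ2).Ck = 𝔏.Ck := rfl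

end Upgrade

section Chain

variable (𝔸) (x : MemberY d ℓ hd hL b₀ b₁ Mstar)

/-- ★★★ **def-Y's v10 FAMILY AT A MEMBER**: the v4 family (symmetrised transporters `parSymY ∕ parBY`, `G′ = GpY`, `C`, printed `U = 1` clauses) with
its NINE `Q`-dependent letters rebuilt over the pair family `(𝔮, 𝔮⋆)` — `GA = G[𝔮 x](U)` at lattice units, `Kdiff = G[𝔮 x](Ω,U) − G[𝔮 x.snd](Ω′,U)`
(second sequence at `parSymY ∕ GpY` of `x.snd`, as `GAsndSY`), and the seven Sect. D∕E composites fed the print-units site propagator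
`G′_phys = GpPhysY (parSymY)` over the residual letter `𝔯.Δ2` (as v4P).  At the straight-contour pair this IS `covLettersY_v4P` (`covLettersY_v10_QY`).
[cite: Balaban1985BackgroundPropagators, (3.26)–(3.27) p.395, (3.115) p.418, (3.122)–(3.132) pp.420–422, (3.153)–(3.154) pp.426–427] -/
def covLettersY_v10 (𝔮 : ∀ i : KIdx d ℓ hd hL b₀ b₁, CfgY 𝔸 i → ((FBondY i → 𝔸) →ₗ[ℂ] (IBondY i → 𝔸)))
    (𝔮s : ∀ i : KIdx d ℓ hd hL b₀ b₁, CfgY 𝔸 i → ((IBondY i → 𝔸) →ₗ[ℂ] (FBondY i → 𝔸)))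
    (h𝔮 : 𝔮 x.toKIdx (fun _ _ => 1) = liftMatY 𝔸 (qK x.toKIdx)) (h𝔮s : 𝔮s x.toKIdx (fun _ _ => 1) = liftMatY 𝔸 (qsK x.toKIdx))
    (𝔯 : ResLettersY 𝔸 x) : CovLettersY 𝔸 x :=
  (covLettersY_v4 𝔸 x 𝔯).withQ 𝔸 𝔮 𝔮s h𝔮 h𝔮s (parSymY x.snd) (GpY x.snd (parSymY x.snd)) (GpPhysY x.toKIdx (parSymY x.toKIdx)) 𝔯.Δ2

variable {x}
variable (𝔮 : ∀ i : KIdx d ℓ hd hL b₀ b₁, CfgY 𝔸 i → ((FBondY i → 𝔸) →ₗ[ℂ] (IBondY i → 𝔸)))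
  (𝔮s : ∀ i : KIdx d ℓ hd hL b₀ b₁, CfgY 𝔸 i → ((IBondY i → 𝔸) →ₗ[ℂ] (FBondY i → 𝔸)))
  (h𝔮 : 𝔮 x.toKIdx (fun _ _ => 1) = liftMatY 𝔸 (qK x.toKIdx)) (h𝔮s : 𝔮s x.toKIdx (fun _ _ => 1) = liftMatY 𝔸 (qsK x.toKIdx))
  (𝔯 : ResLettersY 𝔸 x)

/-- its `GA = G[𝔮 x]` at lattice units. [cite: Balaban1985BackgroundPropagators, (3.27) p.395, bookkeeping] -/
theorem covLettersY_v10_GA : (covLettersY_v10 𝔸 x 𝔮 𝔮s h𝔮 h𝔮s 𝔯).GA =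
    GAQY x.toKIdx (𝔮 x.toKIdx) (𝔮s x.toKIdx) (parSymY x.toKIdx) (GpY x.toKIdx (parSymY x.toKIdx)) := rfl
/-- its `Kdiff = G[𝔮 x](Ω) − G[𝔮 x.snd](Ω′)`. [cite: Balaban1985BackgroundPropagators, (3.154) p.427, bookkeeping] -/
theorem covLettersY_v10_Kdiff : (covLettersY_v10 𝔸 x 𝔮 𝔮s h𝔮 h𝔮s 𝔯).Kdiff = fun U =>
    GAQY x.toKIdx (𝔮 x.toKIdx) (𝔮s x.toKIdx) (parSymY x.toKIdx) (GpY x.toKIdx (parSymY x.toKIdx)) U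
      - GAsndQY 𝔸 x 𝔮 𝔮s (parSymY x.snd) (GpY x.snd (parSymY x.snd)) U := rfl
/-- its `H = H[𝔮 x]` fed `G′_phys`. [cite: Balaban1985BackgroundPropagators, (3.126) p.420, bookkeeping] -/
theorem covLettersY_v10_H : (covLettersY_v10 𝔸 x 𝔮 𝔮s h𝔮 h𝔮s 𝔯).H =
    HDQY x.toKIdx (𝔮 x.toKIdx) (𝔮s x.toKIdx) (parSymY x.toKIdx) (GpPhysY x.toKIdx (parSymY x.toKIdx)) := rfl
/-- its `QGQinv = (𝔮G̃𝔮⋆)⁻¹` fed `G′_phys`. [cite: Balaban1985BackgroundPropagators, (3.132) p.422, bookkeeping] -/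
theorem covLettersY_v10_QGQinv : (covLettersY_v10 𝔸 x 𝔮 𝔮s h𝔮 h𝔮s 𝔯).QGQinv =
    QGQinvQY x.toKIdx (𝔮 x.toKIdx) (𝔮s x.toKIdx) (parSymY x.toKIdx) (GpPhysY x.toKIdx (parSymY x.toKIdx)) := rfl
/-- its `GD = G̃[𝔮 x]` fed `G′_phys`. [cite: Balaban1985BackgroundPropagators, (3.122) p.420, bookkeeping] -/
theorem covLettersY_v10_GD : (covLettersY_v10 𝔸 x 𝔮 𝔮s h𝔮 h𝔮s 𝔯).GD =
    GDQY x.toKIdx (𝔮 x.toKIdx) (𝔮s x.toKIdx) (parSymY x.toKIdx) (GpPhysY x.toKIdx (parSymY x.toKIdx)) := rfl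
/-- its `G₁ = G₁[𝔮 x]` fed `G′_phys` over `𝔯.Δ2`. [cite: Balaban1985BackgroundPropagators, (3.128)–(3.129) p.421, bookkeeping] -/
theorem covLettersY_v10_G₁ : (covLettersY_v10 𝔸 x 𝔮 𝔮s h𝔮 h𝔮s 𝔯).G₁ =
    G1QY x.toKIdx (𝔮 x.toKIdx) (𝔮s x.toKIdx) (parSymY x.toKIdx) (GpPhysY x.toKIdx (parSymY x.toKIdx)) 𝔯.Δ2 := rfl
/-- its `QG1Qinv = (𝔮G₁𝔮⋆)⁻¹`. [cite: Balaban1985BackgroundPropagators, (3.132) p.422, bookkeeping] -/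
theorem covLettersY_v10_QG1Qinv : (covLettersY_v10 𝔸 x 𝔮 𝔮s h𝔮 h𝔮s 𝔯).QG1Qinv =
    QG1QinvQY x.toKIdx (𝔮 x.toKIdx) (𝔮s x.toKIdx) (parSymY x.toKIdx) (GpPhysY x.toKIdx (parSymY x.toKIdx)) 𝔯.Δ2 := rfl
/-- its `H₁ = H₁[𝔮 x]`. [cite: Balaban1985BackgroundPropagators, (3.129) p.421, bookkeeping] -/
theorem covLettersY_v10_H₁ : (covLettersY_v10 𝔸 x 𝔮 𝔮s h𝔮 h𝔮s 𝔯).H₁ =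
    H1QY x.toKIdx (𝔮 x.toKIdx) (𝔮s x.toKIdx) (parSymY x.toKIdx) (GpPhysY x.toKIdx (parSymY x.toKIdx)) 𝔯.Δ2 := rfl
/-- its `GG = 𝔊[𝔮 x]`. [cite: Balaban1985BackgroundPropagators, (3.153) p.426, bookkeeping] -/
theorem covLettersY_v10_GG : (covLettersY_v10 𝔸 x 𝔮 𝔮s h𝔮 h𝔮s 𝔯).GG =
    GGQY x.toKIdx (𝔮 x.toKIdx) (𝔮s x.toKIdx) (parSymY x.toKIdx) (GpPhysY x.toKIdx (parSymY x.toKIdx)) 𝔯.Δ2 := rfl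
/-- its site transporter is the symmetrised one. [cite: Balaban1985BackgroundPropagators, (3.24) p.394, bookkeeping] -/
theorem covLettersY_v10_parS : (covLettersY_v10 𝔸 x 𝔮 𝔮s h𝔮 h𝔮s 𝔯).parS = parSymY x.toKIdx := rfl
/-- its bond transporter (readers) is the taxicab one. [cite: Balaban1985BackgroundPropagators, (3.40) p.397, bookkeeping] -/
theorem covLettersY_v10_parB : (covLettersY_v10 𝔸 x 𝔮 𝔮s h𝔮 h𝔮s 𝔯).parB = parBY x.toKIdx := rfl
/-- its `G′` is `GpY (parSymY)` (lattice units). [cite: Balaban1985BackgroundPropagators, (3.25) p.395, bookkeeping] -/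
theorem covLettersY_v10_Gp : (covLettersY_v10 𝔸 x 𝔮 𝔮s h𝔮 h𝔮s 𝔯).Gp = GpY x.toKIdx (parSymY x.toKIdx) := rfl
/-- its `C` is v4's. [cite: Balaban1985BackgroundPropagators, (3.48) p.398, bookkeeping] -/
theorem covLettersY_v10_C : (covLettersY_v10 𝔸 x 𝔮 𝔮s h𝔮 h𝔮s 𝔯).C = (covLettersY_v4 𝔸 x 𝔯).C := rfl

/-- ★★★ **THE v10 FAMILY AT THE STRAIGHT-CONTOUR PAIR IS THE v4P FAMILY** (`rfl`): every v ≤ 9 consumer is a v10 consumer at `𝔮 := QY · (parBY ·)`.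
[cite: Balaban1985BackgroundPropagators, (3.12)–(3.13) p.393, (3.122)–(3.132) pp.420–422, bookkeeping] -/
theorem covLettersY_v10_QY (𝔯 : ResLettersY 𝔸 x) :
    covLettersY_v10 𝔸 x (fun i => QY i (parBY i)) (fun i => QsY i (parBY i)) (QY_one x.toKIdx (parBY_one x.toKIdx))
      (QsY_one x.toKIdx (parBY_one x.toKIdx)) 𝔯 = covLettersY_v4P 𝔸 x 𝔯 := rfl

end Chain

/-! ## §5 The record's carriers: the v10 letters of record over a pair family of `OpsYQLetter.QFamY`-shape -/

section Record

open scoped Matrix.Norms.L2Operator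

variable (N : ℕ) (θ : Stage3Params) (Mstar : ℕ)

/-- ★★★ **THE v10 LETTERS OF RECORD** over an index-level averaging pair family `(𝔮, 𝔮⋆)` flat at `U = 1` and a residual family `𝔯`.
[cite: Balaban1985BackgroundPropagators, (3.115) p.418, (3.122)–(3.132) pp.420–422] -/
def lettersYOfRecordV10
    (𝔮 : ∀ i : KIdx θ.d₆ θ.ℓ₆ θ.hd' θ.hL' θ.b₀ θ.b₁, CfgY (Matrix (Fin N) (Fin N) ℂ) i →
      ((FBondY i → Matrix (Fin N) (Fin N) ℂ) →ₗ[ℂ] (IBondY i → Matrix (Fin N) (Fin N) ℂ)))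
    (𝔮s : ∀ i : KIdx θ.d₆ θ.ℓ₆ θ.hd' θ.hL' θ.b₀ θ.b₁, CfgY (Matrix (Fin N) (Fin N) ℂ) i →
      ((IBondY i → Matrix (Fin N) (Fin N) ℂ) →ₗ[ℂ] (FBondY i → Matrix (Fin N) (Fin N) ℂ)))
    (h𝔮 : ∀ i, 𝔮 i (fun _ _ => 1) = liftMatY (Matrix (Fin N) (Fin N) ℂ) (qK i))
    (h𝔮s : ∀ i, 𝔮s i (fun _ _ => 1) = liftMatY (Matrix (Fin N) (Fin N) ℂ) (qsK i)) (𝔯 : ResY N θ Mstar) : LettersY N θ Mstar :=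
  fun x => covLettersY_v10 (Matrix (Fin N) (Fin N) ℂ) x 𝔮 𝔮s (h𝔮 x.toKIdx) (h𝔮s x.toKIdx) (𝔯 x)

variable {N θ Mstar}

/-- the v10 letters of record at a member (`rfl`). [cite: Balaban1985BackgroundPropagators, (3.122)–(3.132) pp.420–422, bookkeeping] -/
theorem lettersYOfRecordV10_apply
    (𝔮 : ∀ i : KIdx θ.d₆ θ.ℓ₆ θ.hd' θ.hL' θ.b₀ θ.b₁, CfgY (Matrix (Fin N) (Fin N) ℂ) i →
      ((FBondY i → Matrix (Fin N) (Fin N) ℂ) →ₗ[ℂ] (IBondY i → Matrix (Fin N) (Fin N) ℂ)))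
    (𝔮s : ∀ i : KIdx θ.d₆ θ.ℓ₆ θ.hd' θ.hL' θ.b₀ θ.b₁, CfgY (Matrix (Fin N) (Fin N) ℂ) i →
      ((IBondY i → Matrix (Fin N) (Fin N) ℂ) →ₗ[ℂ] (FBondY i → Matrix (Fin N) (Fin N) ℂ)))
    (h𝔮 : ∀ i, 𝔮 i (fun _ _ => 1) = liftMatY (Matrix (Fin N) (Fin N) ℂ) (qK i))
    (h𝔮s : ∀ i, 𝔮s i (fun _ _ => 1) = liftMatY (Matrix (Fin N) (Fin N) ℂ) (qsK i)) (𝔯 : ResY N θ Mstar)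
    (x : MemberY θ.d₆ θ.ℓ₆ θ.hd' θ.hL' θ.b₀ θ.b₁ Mstar) :
    lettersYOfRecordV10 N θ Mstar 𝔮 𝔮s h𝔮 h𝔮s 𝔯 x = covLettersY_v10 (Matrix (Fin N) (Fin N) ℂ) x 𝔮 𝔮s (h𝔮 x.toKIdx) (h𝔮s x.toKIdx) (𝔯 x) := rfl

/-- ★★★ **THE v10 LETTERS OF RECORD AT THE STRAIGHT-CONTOUR PAIR ARE THE v4P LETTERS OF RECORD** (pointwise `rfl`).
[cite: Balaban1985BackgroundPropagators, (3.12)–(3.13) p.393, bookkeeping] -/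
theorem lettersYOfRecordV10_QY (𝔯 : ResY N θ Mstar) :
    lettersYOfRecordV10 N θ Mstar (fun i => QY i (parBY i)) (fun i => QsY i (parBY i)) (fun i => QY_one i (parBY_one i))
      (fun i => QsY_one i (parBY_one i)) 𝔯 = lettersYOfRecordV4P N θ Mstar 𝔯 :=
  funext fun x => covLettersY_v10_QY (Matrix (Fin N) (Fin N) ℂ) (𝔯 x)

end Record

end

end Literature.MathematicalPhysics.QuantumFieldTheory.Balaban1983to89.Node00
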